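import Summits.ResolutionOfSingularities.ResolutionOfSingularities.Theorems.PurelyInseparableDim4ChartAtlasAlgebra
import Summits.ResolutionOfSingularities.ResolutionOfSingularities.Theorems.PurelyInseparableDim4ChartClosureStrict
import Summits.ResolutionOfSingularities.ResolutionOfSingularities.Theorems.PurelyInseparableDim4ChartClosureSupport
import Summits.ResolutionOfSingularities.ResolutionOfSingularities.Theorems.PurelyInseparableDim4ChartBoundary
import HarnessLib

/-!
# Purely inseparable four-folds `z^p + F(x₁, …, x₄)`: the escaping global centre and the transform READ ON THE
# re-centred `x_l`-CHART — sheaf level (brick S3-N1 «atlas of an escaping global centre», part E2; cell `res-dim4-pi`,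
# typ-2 g5)

[OURS · counted 0] (D-0157 DOOR 2; DR-157-C; desk WORD #115 (a) (S3-N1) «cover of `Zc` by the charts `W[⊤, x_λ]`,
`λ ∈ Λ_S ∖ Λ_{S'}`, via `support_strictTransformIdeal_graph` + the strict-transform chart law»; typ-3 g4 K-20a «packages
against `M.boundary = E`»; frame `PIDim4.TerminationImpliesOrderReduction`, S3 (c)). Setting of B2/D1/D3 (typ-2 g4):
`π : W → 𝔸⁵_K` ANY blowing up along `V(z, x_S)`, `j ∈ S ∖ S'`, `Θⱼ` the re-centring of the `x_j`-chart READING the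
transform (`Θⱼ(ψⱼ(z^p + F)) = x_j^p (z^p + F₁)`), `S'` permissible for `F₁`, `φⱼ = Spec Θⱼ ≫ chartImm_j`,
`Zc = 𝓘(closure φⱼ(V(z, x_{S'})))` the GLOBAL CENTRE (= `St_π(𝒥_Y)`, B2). NEW: another centre variable
`l ∈ S ∖ S'`, `l ≠ j`, and a SHEAR re-centring `Θ` of the `x_l`-chart (E1: `Θ z = z + g`, `Θ|_{K[x]} = τ`, `τ x_l = x_l`,
`τ x_j = x_j`, `τ xᵢ = xᵢ + bᵢ x_j` (`i ∈ S' ∩ S`), `τ x_k = x_k + b_k` (`k ∈ S' ∖ S`), `g ≡ τ H_l (mod x_{S'})`),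
`φ_l = Spec Θ ≫ chartImm_l`. PROVED here (no `sorry`, no new axiom), for EVERY boundary `E` of the marked ideal
`M = ((z^p + F)·𝒪, E, p)` (the readings do not see `E`):

* `comap_shear_chart_strictTransformIdeal_graph` — `φ_l^* St_π(𝒥_Y) = 𝓘Λ_{S'}`;
* **`comap_shear_chart_globalCentre`** — `φ_l^* Zc = 𝓘Λ_{S'}`: ON THE `x_l`-CHART THE GLOBAL CENTRE READS AS THE SAME
  COORDINATE SUBSPACE `V(z, x_{S'})`;
* **`comap_shear_chart_transform_ideal`** — `φ_l^* (M.transform π 𝓘Λ_S).ideal = (z^p + F_l)·𝒪`,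
  `F_l := g^p + τ(chartTransform p S l F)`;
* `image_shear_chart_subset_support_globalCentre` — `φ_l(V(z, x_{S'})) ⊆ V(Zc)`;
* **`le_ordAlong_shear_reading`** — `p ≤ ord_{(x_{S'})} F_l`: the reading on the `x_l`-chart is again PERMISSIBLE for
  `S'` (D1's Q2 `V(Zc) ⊆ supp` read back through `φ_l` and the permissibility dictionary `…CentreAdmissible`);
* `comap_shear_chart_exceptional` — the new exceptional component `π⁻¹𝓘Λ_S · 𝒪_W` reads `x_l · 𝒪` on `φ_l`.

HONEST SCOPE: `K` perfect of characteristic `p` where Q2 is used. The cover `V(Zc) ⊆ ⋃_{l ∈ S∖S'} range φ_l`, the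
cleaning of `F_l` and the packaged atlas are the sequel E3; the snc/shape of OLDER boundary members (depth ≥ 3, S3-N2)
is not addressed. Nothing here is a statement about resolution of singularities in dimension ≥ 4 / characteristic `p`
(NOT proved anywhere in this programme). bears_on: LADDER-RESOLUTION:D157-DOOR2 (res-dim4-pi). Supports
stmt-ResolutionOfSingularities-16155 (helper, S3-N1 E2).
-/

-- every declaration of this summit lives under `Summit.ResolutionOfSingularities.ResolutionOfSingularities`
-- (summit = problem), which the duplicate-namespace linter flags; house convention (cf. the Target file).
set_option linter.dupNamespace false

noncomputable section

open MvPolynomial Finset CategoryTheory AlgebraicGeometry Opposite TopologicalSpace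
open AlgebraicGeometry.Scheme.IdealSheafData (ofIdealTop vanishingIdeal)

namespace Summit.ResolutionOfSingularities.ResolutionOfSingularities.Theorems.PIDim4

open Literature.AlgebraicGeometry.Resolution
open Literature.AlgebraicGeometry.Resolution.AffinePointBlowup (P A γ coord Wtop ξ)

namespace ChartDictionary

variable {K : Type} [Field K] {p : ℕ} {S S' : Finset (Fin 4)} {j l : Fin 4} {b : Fin 4 → K}
  {Θⱼ : A 4 K ≃ₐ[K] A 4 K} {h : MvPolynomial (Fin 4) K} {F F₁ : MvPolynomial (Fin 4) K}
  {Θ : A 4 K ≃ₐ[K] A 4 K} {τ : MvPolynomial (Fin 4) K ≃ₐ[K] MvPolynomial (Fin 4) K} {g : MvPolynomial (Fin 4) K}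
  {W : Scheme.{0}} {π : W ⟶ P 4 K}

/-! ## §1 The strict transform of the graph and the global centre on the `x_l`-chart -/

/-- **`φ_l^* St_π(𝒥_Y) = 𝓘Λ_{S'}`**: on the re-centred `x_l`-chart the strict transform of the graph `Y` is the
coordinate subspace `V(z, x_{S'})` (E1's `map_shear_coordStrictTransformIdeal_graph`, transported through `idealSheafOf`
exactly as in B2). -/
theorem comap_shear_chart_strictTransformIdeal_graph (hj : j ∈ S) (hl : l ∈ S) (hlS' : l ∉ S') (hjl : j ≠ l)
    (h0 : Θ (X 0) = X 0 + rename Fin.succ g) (hτ : ∀ i : Fin 4, Θ (X i.succ) = rename Fin.succ (τ (X i)))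
    (hτl : τ (X l) = X l) (hτj : τ (X j) = X j) (hτ1 : ∀ i ∈ S' ∩ S, τ (X i) = X i + C (b i) * X j)
    (hτ2 : ∀ k ∈ S' \ S, τ (X k) = X k + C (b k))
    (hπ : IsBlowup π (AffineCoordBlowup.𝓘Λ 4 K (insert 0 (Fin.succ '' (S : Set (Fin 4))))))
    {H Hl : MvPolynomial (Fin 4) K} (hHl : coordBlowupSubst K (S : Set (Fin 4)) l H = X l * Hl)
    (hg : g - τ Hl ∈ Ideal.span (X '' (S' : Set (Fin 4)) : Set (MvPolynomial (Fin 4) K))) :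
    (strictTransformIdeal π (AffineCoordBlowup.𝓘Λ 4 K (insert 0 (Fin.succ '' (S : Set (Fin 4)))))
        (Hironaka2005.idealSheafOf (Ideal.span (insert (X 0 - rename Fin.succ H)
          (((fun k : Fin 4 => (X k.succ - C (b k) : A 4 K)) '' ((S' \ S : Finset (Fin 4)) : Set (Fin 4))) ∪
           ((fun i : Fin 4 => (X i.succ - C (b i) * X j.succ : A 4 K)) '' ((S' ∩ S : Finset (Fin 4)) : Set (Fin 4)))))))).comap
      (Spec.map (CommRingCat.ofHom (Θ : A 4 K →+* A 4 K)) ≫ AffineCoordBlowup.chartImm hπ (succ_mem_centreVars hl)) =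
      AffineCoordBlowup.𝓘Λ 4 K (insert 0 (Fin.succ '' (S' : Set (Fin 4)))) := by
  rw [Scheme.IdealSheafData.comap_comp, comap_chartImm_strictTransformIdeal_idealSheafOf hl hπ,
    Hironaka2005.comap_specMap_idealSheafOf,
    map_shear_coordStrictTransformIdeal_graph hj hlS' hjl h0 hτ hτl hτj hτ1 hτ2 hHl hg,
    ← Cruxes.EquisingularLiftNat.Sections.ND.𝓘Λ_eq_idealSheafOf]

/-- **`φ_l^* Zc = 𝓘Λ_{S'}`: THE GLOBAL CENTRE READ ON THE re-centred `x_l`-CHART IS THE SAME COORDINATE SUBSPACE.**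
Here `Zc = 𝓘(closure φⱼ(V(z, x_{S'})))` is defined through the `x_j`-chart re-centring `Θⱼ` of the walk (reading the
transform, `S'` permissible for the reading), and equals `St_π(𝒥_Y)` (B2); `H` is the lift of A2 and `H_l` its
`x_l`-chart quotient. -/
theorem comap_shear_chart_globalCentre [Fact p.Prime] [CharP K p] (hj : j ∈ S) (hjS' : j ∉ S') (hbj : b j = 0)
    (h0j : Θⱼ (X 0) = X 0 + rename Fin.succ h) (hsj : ∀ i : Fin 4, Θⱼ (X i.succ) = X i.succ + C (b i))
    (hπ : IsBlowup π (AffineCoordBlowup.𝓘Λ 4 K (insert 0 (Fin.succ '' (S : Set (Fin 4))))))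
    {H : MvPolynomial (Fin 4) K} (hH : coordBlowupSubst K (S : Set (Fin 4)) j H =
      X j * aeval (fun k => if k ∈ S' then (0 : MvPolynomial (Fin 4) K) else X k - C (b k)) h)
    (hl : l ∈ S) (hlS' : l ∉ S') (hjl : j ≠ l)
    (h0 : Θ (X 0) = X 0 + rename Fin.succ g) (hτ : ∀ i : Fin 4, Θ (X i.succ) = rename Fin.succ (τ (X i)))
    (hτl : τ (X l) = X l) (hτj : τ (X j) = X j) (hτ1 : ∀ i ∈ S' ∩ S, τ (X i) = X i + C (b i) * X j)
    (hτ2 : ∀ k ∈ S' \ S, τ (X k) = X k + C (b k))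
    {Hl : MvPolynomial (Fin 4) K} (hHl : coordBlowupSubst K (S : Set (Fin 4)) l H = X l * Hl)
    (hg : g - τ Hl ∈ Ideal.span (X '' (S' : Set (Fin 4)) : Set (MvPolynomial (Fin 4) K))) :
    haveI : IsIso (CommRingCat.ofHom (Θⱼ : A 4 K →+* A 4 K)) :=
      (inferInstance : IsIso Θⱼ.toRingEquiv.toCommRingCatIso.hom)
    (vanishingIdeal (closureImage
        (Spec.map (CommRingCat.ofHom (Θⱼ : A 4 K →+* A 4 K)) ≫ AffineCoordBlowup.chartImm hπ (succ_mem_centreVars hj))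
        ((AffineCoordBlowup.𝓘Λ 4 K (insert 0 (Fin.succ '' (S' : Set (Fin 4))))).support : Set (P 4 K)))).comap
      (Spec.map (CommRingCat.ofHom (Θ : A 4 K →+* A 4 K)) ≫ AffineCoordBlowup.chartImm hπ (succ_mem_centreVars hl)) =
      AffineCoordBlowup.𝓘Λ 4 K (insert 0 (Fin.succ '' (S' : Set (Fin 4)))) := by
  rw [← strictTransformIdeal_graph_eq_globalCentre hj hjS' hbj h0j hsj hπ hH]
  exact comap_shear_chart_strictTransformIdeal_graph hj hl hlS' hjl h0 hτ hτl hτj hτ1 hτ2 hπ hHl hg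

/-! ## §2 The transform on the `x_l`-chart -/

/-- **`φ_l^* (M.transform π 𝓘Λ_S).ideal = (z^p + F_l)·𝒪`**, `F_l = g^p + τ F'_l`, for every marked ideal
`M = ((z^p + F)·𝒪, E, p)` with `p ≤ ord_{(x_S)} F` and every re-centring `Θ` (`Θ z = z + g`, `Θ|_{K[x]} = τ`; the
controlled transform read on the chart, `…ChartTransfer`, then `Spec Θ`, then E1's `shear_hyp`). -/
theorem comap_shear_chart_transform_ideal [Fact p.Prime] [CharP K p] (hl : l ∈ S)
    (h0 : Θ (X 0) = X 0 + rename Fin.succ g) (hτ : ∀ i : Fin 4, Θ (X i.succ) = rename Fin.succ (τ (X i)))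
    (hπ : IsBlowup π (AffineCoordBlowup.𝓘Λ 4 K (insert 0 (Fin.succ '' (S : Set (Fin 4))))))
    (hperm : (p : ℕ∞) ≤ CentreBlowup.ordAlong S F)
    (M : MarkedIdeal (P 4 K)) (hMI : M.ideal = hypSheaf p F) (hMm : M.mult = p) :
    (M.transform π (AffineCoordBlowup.𝓘Λ 4 K (insert 0 (Fin.succ '' (S : Set (Fin 4)))))).ideal.comap
        (Spec.map (CommRingCat.ofHom (Θ : A 4 K →+* A 4 K)) ≫ AffineCoordBlowup.chartImm hπ (succ_mem_centreVars hl)) =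
      hypSheaf p (g ^ p + τ (CentreBlowup.chartTransform p S l F)) := by
  have hΘ : Θ (hyp p (CentreBlowup.chartTransform p S l F)) = hyp p (g ^ p + τ (CentreBlowup.chartTransform p S l F)) :=
    shear_hyp h0 hτ _
  rw [MarkedIdeal.transform_ideal, hMI, hMm, Scheme.IdealSheafData.comap_comp,
    controlledTransform_comap_chartImm p hl F hperm hπ, comap_hypSheaf_specMap]
  change ofIdealTop (Ideal.span {(γ 4 K).symm (Θ (hyp p (CentreBlowup.chartTransform p S l F)))}) = _
  rw [hΘ]
  rfl

/-! ## §3 Permissibility of the reading on the `x_l`-chart -/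

/-- **`φ_l(V(z, x_{S'})) ⊆ V(Zc)`**: the coordinate subspace of the `x_l`-chart maps into the global centre
(immediate from `φ_l^* Zc = 𝓘Λ_{S'}`). -/
theorem image_shear_chart_subset_support_globalCentre [Fact p.Prime] [CharP K p] (hj : j ∈ S) (hjS' : j ∉ S')
    (hbj : b j = 0) (h0j : Θⱼ (X 0) = X 0 + rename Fin.succ h) (hsj : ∀ i : Fin 4, Θⱼ (X i.succ) = X i.succ + C (b i))
    (hπ : IsBlowup π (AffineCoordBlowup.𝓘Λ 4 K (insert 0 (Fin.succ '' (S : Set (Fin 4))))))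
    {H : MvPolynomial (Fin 4) K} (hH : coordBlowupSubst K (S : Set (Fin 4)) j H =
      X j * aeval (fun k => if k ∈ S' then (0 : MvPolynomial (Fin 4) K) else X k - C (b k)) h)
    (hl : l ∈ S) (hlS' : l ∉ S') (hjl : j ≠ l)
    (h0 : Θ (X 0) = X 0 + rename Fin.succ g) (hτ : ∀ i : Fin 4, Θ (X i.succ) = rename Fin.succ (τ (X i)))
    (hτl : τ (X l) = X l) (hτj : τ (X j) = X j) (hτ1 : ∀ i ∈ S' ∩ S, τ (X i) = X i + C (b i) * X j)
    (hτ2 : ∀ k ∈ S' \ S, τ (X k) = X k + C (b k))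
    {Hl : MvPolynomial (Fin 4) K} (hHl : coordBlowupSubst K (S : Set (Fin 4)) l H = X l * Hl)
    (hg : g - τ Hl ∈ Ideal.span (X '' (S' : Set (Fin 4)) : Set (MvPolynomial (Fin 4) K))) :
    haveI : IsIso (CommRingCat.ofHom (Θⱼ : A 4 K →+* A 4 K)) :=
      (inferInstance : IsIso Θⱼ.toRingEquiv.toCommRingCatIso.hom)
    (Spec.map (CommRingCat.ofHom (Θ : A 4 K →+* A 4 K)) ≫ AffineCoordBlowup.chartImm hπ (succ_mem_centreVars hl)) ''
        (AffineCoordBlowup.CΛ 4 K (insert 0 (Fin.succ '' (S' : Set (Fin 4)))) : Set (P 4 K)) ⊆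
      ((vanishingIdeal (closureImage
        (Spec.map (CommRingCat.ofHom (Θⱼ : A 4 K →+* A 4 K)) ≫ AffineCoordBlowup.chartImm hπ (succ_mem_centreVars hj))
        ((AffineCoordBlowup.𝓘Λ 4 K (insert 0 (Fin.succ '' (S' : Set (Fin 4))))).support : Set (P 4 K)))).support :
          Set W) := by
  haveI : IsIso (CommRingCat.ofHom (Θⱼ : A 4 K →+* A 4 K)) :=
    (inferInstance : IsIso Θⱼ.toRingEquiv.toCommRingCatIso.hom)
  have hcomap := comap_shear_chart_globalCentre hj hjS' hbj h0j hsj hπ hH hl hlS' hjl h0 hτ hτl hτj hτ1 hτ2 hHl hg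
  rintro _ ⟨y, hy, rfl⟩
  have h2 : y ∈ ((vanishingIdeal (closureImage
        (Spec.map (CommRingCat.ofHom (Θⱼ : A 4 K →+* A 4 K)) ≫ AffineCoordBlowup.chartImm hπ (succ_mem_centreVars hj))
        ((AffineCoordBlowup.𝓘Λ 4 K (insert 0 (Fin.succ '' (S' : Set (Fin 4))))).support : Set (P 4 K)))).comap
      (Spec.map (CommRingCat.ofHom (Θ : A 4 K →+* A 4 K)) ≫
        AffineCoordBlowup.chartImm hπ (succ_mem_centreVars hl))).support := by
    rw [hcomap, AffineCoordBlowup.support_𝓘Λ]; exact hy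
  rw [Scheme.IdealSheafData.support_comap] at h2
  exact h2

/-- **THE READING ON THE `x_l`-CHART IS PERMISSIBLE FOR `S'`**: `p ≤ ord_{(x_{S'})} (g^p + τ F'_l)`. Over a perfect
field of characteristic `p`: `φ_l(V(z, x_{S'})) ⊆ V(Zc) ⊆ supp(M')` (D1's Q2), orders are read on the chart through the
open immersion `φ_l`, and `…CentreAdmissible` turns «`V(z, x_{S'}) ⊆ supp((z^p + F_l)·𝒪, p)`» into the order
inequality. -/
theorem le_ordAlong_shear_reading [hp : Fact p.Prime] [CharP K p] [PerfectField K] (hj : j ∈ S) (hjS' : j ∉ S')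
    (hbj : b j = 0) (h0j : Θⱼ (X 0) = X 0 + rename Fin.succ h) (hsj : ∀ i : Fin 4, Θⱼ (X i.succ) = X i.succ + C (b i))
    (hπ : IsBlowup π (AffineCoordBlowup.𝓘Λ 4 K (insert 0 (Fin.succ '' (S : Set (Fin 4))))))
    (hperm : (p : ℕ∞) ≤ CentreBlowup.ordAlong S F)
    (hread : Θⱼ (coordBlowupSubst K (insert 0 (Fin.succ '' (S : Set (Fin 4)))) j.succ (hyp p F)) =
      X j.succ ^ p * hyp p F₁)
    (hperm' : (p : ℕ∞) ≤ CentreBlowup.ordAlong S' F₁)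
    {H : MvPolynomial (Fin 4) K} (hH : coordBlowupSubst K (S : Set (Fin 4)) j H =
      X j * aeval (fun k => if k ∈ S' then (0 : MvPolynomial (Fin 4) K) else X k - C (b k)) h)
    (hl : l ∈ S) (hlS' : l ∉ S') (hjl : j ≠ l)
    (h0 : Θ (X 0) = X 0 + rename Fin.succ g) (hτ : ∀ i : Fin 4, Θ (X i.succ) = rename Fin.succ (τ (X i)))
    (hτl : τ (X l) = X l) (hτj : τ (X j) = X j) (hτ1 : ∀ i ∈ S' ∩ S, τ (X i) = X i + C (b i) * X j)
    (hτ2 : ∀ k ∈ S' \ S, τ (X k) = X k + C (b k))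
    {Hl : MvPolynomial (Fin 4) K} (hHl : coordBlowupSubst K (S : Set (Fin 4)) l H = X l * Hl)
    (hg : g - τ Hl ∈ Ideal.span (X '' (S' : Set (Fin 4)) : Set (MvPolynomial (Fin 4) K))) :
    (p : ℕ∞) ≤ CentreBlowup.ordAlong S' (g ^ p + τ (CentreBlowup.chartTransform p S l F)) := by
  haveI : IsIso (CommRingCat.ofHom (Θⱼ : A 4 K →+* A 4 K)) :=
    (inferInstance : IsIso Θⱼ.toRingEquiv.toCommRingCatIso.hom)
  haveI : IsIso (CommRingCat.ofHom (Θ : A 4 K →+* A 4 K)) :=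
    (inferInstance : IsIso Θ.toRingEquiv.toCommRingCatIso.hom)
  set φ := Spec.map (CommRingCat.ofHom (Θ : A 4 K →+* A 4 K)) ≫ AffineCoordBlowup.chartImm hπ (succ_mem_centreVars hl)
    with hφ
  set M' := ((⟨hypSheaf p F, [], p⟩ : MarkedIdeal (P 4 K)).transform π
    (AffineCoordBlowup.𝓘Λ 4 K (insert 0 (Fin.succ '' (S : Set (Fin 4)))))) with hM'
  refine le_ordAlong_of_CΛ_subset_support hp.out.ne_zero S' _ [] fun y hy => ?_
  -- `φ y ∈ V(Zc) ⊆ supp M'`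
  have h1 : φ y ∈ M'.support :=
    support_globalCentre_subset_support_transform hj hbj h0j hsj hπ hperm hread hperm'
      (image_shear_chart_subset_support_globalCentre hj hjS' hbj h0j hsj hπ hH hl hlS' hjl h0 hτ hτl hτj hτ1 hτ2 hHl hg
        ⟨y, hy, rfl⟩)
  -- read the order on the chart
  change ((p : ℕ) : ℕ∞) ≤ idealOrder (hypSheaf p (g ^ p + τ (CentreBlowup.chartTransform p S l F))) y
  rw [← comap_shear_chart_transform_ideal hl h0 hτ hπ hperm (⟨hypSheaf p F, [], p⟩ : MarkedIdeal (P 4 K)) rfl rfl,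
    idealOrder_comap_of_isOpenImmersion]
  exact h1

/-! ## §4 The new exceptional component on the `x_l`-chart -/

/-- **The exceptional component reads `x_l · 𝒪`** on the re-centred `x_l`-chart (the shear fixes `x_l`): for the
boundary `[E₁] = [π⁻¹𝓘Λ_S · 𝒪_W]` of the transform of `((z^p + F)·𝒪, [], p)` this is the translated-shape datum
`(idx, cst) = (l, 0)` of typ-3's member format. -/
theorem comap_shear_chart_exceptional (hl : l ∈ S) (hτ : ∀ i : Fin 4, Θ (X i.succ) = rename Fin.succ (τ (X i)))
    (hτl : τ (X l) = X l) (hπ : IsBlowup π (AffineCoordBlowup.𝓘Λ 4 K (insert 0 (Fin.succ '' (S : Set (Fin 4)))))) :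
    ((AffineCoordBlowup.𝓘Λ 4 K (insert 0 (Fin.succ '' (S : Set (Fin 4))))).comap π).comap
        (Spec.map (CommRingCat.ofHom (Θ : A 4 K →+* A 4 K)) ≫ AffineCoordBlowup.chartImm hπ (succ_mem_centreVars hl)) =
      ofIdealTop (Ideal.span {(γ 4 K).symm (X l.succ + C 0)}) := by
  rw [C_0, add_zero]
  exact comap_exceptional_chart hl (Θ := (Θ : A 4 K →+* A 4 K)) (shear_X_succ_of_eq hτ hτl) hπ

/-- The boundary of the transform of the root marked ideal is the single exceptional component. -/
theorem transform_boundary_root (E : (P 4 K).IdealSheafData) (q : ℕ)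
    (hπ : IsBlowup π (AffineCoordBlowup.𝓘Λ 4 K (insert 0 (Fin.succ '' (S : Set (Fin 4)))))) :
    (((⟨E, [], q⟩ : MarkedIdeal (P 4 K)).transform π
        (AffineCoordBlowup.𝓘Λ 4 K (insert 0 (Fin.succ '' (S : Set (Fin 4)))))).boundary) =
      [(AffineCoordBlowup.𝓘Λ 4 K (insert 0 (Fin.succ '' (S : Set (Fin 4))))).comap π] := by
  have := hπ
  rw [MarkedIdeal.transform_boundary, List.map_nil, List.nil_append]

end ChartDictionary

end Summit.ResolutionOfSingularities.ResolutionOfSingularities.Theorems.PIDim4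

end
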